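import Mathlib
import Summits.Parity.GeneralizedHardyLittlewood.Theses.LiouvilleMAD

/-!
# Sketch (crux-ideate, ideator 2, round 1) — crux stmt-Parity-13317 `LiouvilleMAD.CosetDecorrelation`

Gram anatomy of the coset sum
`T_j = Σ_{(m,m') ∈ (M,2M]², m ≡ m' (j)} f(m) g(m')`, `f(m) = λ(mn+c)`, `g(m') = λ(m'n'+c)`:

* `cosetSum_eq_sum_classSum` (PROVED): `T_j = Σ_{a<j} A_f(a) A_g(a)`, `A_f(a) = Σ_{m ≡ a} f(m)` — the coset sum is
  the inner product of the two class-sum vectors in `ℝ^{ℤ/j}`;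
* `gram_split` (PROVED): `Σ_a A(a)B(a) = (ΣA)(ΣB)/j + Σ_a (A(a) − ΣA/j)(B(a) − ΣB/j)` — rank-one MEAN MODE plus
  FLUCTUATION;
* `MeanMode`, `FluctMode` (typed hypotheses) and `cosetDecorrelation_of_modes` (PROVED composition):
  `(∀ c ≠ 0, ∃ ϑ < 1/4, MeanMode c ϑ ∧ FluctMode c ϑ) → CosetDecorrelation`.

The mean mode is `S(n)S(n')/j` with `S(n) = Σ_{m∈(M,2M]} λ(mn+c)` (λ in the progression `c mod n`, length `M`);
the fluctuation is `(1/j) Σ_{b ≢ 0 (j)} Ĝ_n(b/j) conj Ĝ_{n'}(b/j)`, `Ĝ_n(β) = Σ_m λ(mn+c) e(βm)` (card `gram-split-farey-phase`).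
-/

namespace Summit.Parity.GeneralizedHardyLittlewood.Cruxes.CosetDecorrelation.SketchIdeator2

open scoped BigOperators Classical
open Finset

/-- Class sum `A_f(j,a) = Σ_{m ∈ (M,2M], m % j = a} f m`. -/
noncomputable def classSum (f : ℕ → ℝ) (M j a : ℕ) : ℝ :=
  ∑ m ∈ (Finset.Ioc M (2 * M)).filter (fun m => m % j = a), f m

/-- Block sum `S_f = Σ_{m ∈ (M,2M]} f m`. -/
noncomputable def blockSum (f : ℕ → ℝ) (M : ℕ) : ℝ :=
  ∑ m ∈ Finset.Ioc M (2 * M), f m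

/-- The coset sum of the crux for general weights `f, g`. -/
noncomputable def cosetSum (f g : ℕ → ℝ) (M j : ℕ) : ℝ :=
  ∑ p ∈ (Finset.Ioc M (2 * M) ×ˢ Finset.Ioc M (2 * M)).filter (fun p : ℕ × ℕ => p.1 ≡ p.2 [MOD j]),
    f p.1 * g p.2

/-- The crux's weight `m ↦ λ(mn + c)` (exactly the spelling of `LiouvilleMAD.CosetDecorrelation`). -/
noncomputable def lamAP (n : ℕ) (c : ℤ) (m : ℕ) : ℝ :=
  (ArithmeticFunction.liouville (Int.toNat ((m : ℤ) * n + c)) : ℝ)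

/-- **Gram form** (E1): the coset sum is the inner product of the two class-sum vectors. -/
theorem cosetSum_eq_sum_classSum (f g : ℕ → ℝ) (M j : ℕ) (hj : 0 < j) :
    cosetSum f g M j = ∑ a ∈ Finset.range j, classSum f M j a * classSum g M j a := by
  unfold cosetSum classSum
  rw [Finset.sum_filter, Finset.sum_product]
  simp_rw [Finset.sum_filter, Finset.sum_mul_sum]
  conv_rhs => rw [Finset.sum_comm]
  refine Finset.sum_congr rfl fun x _ => ?_
  rw [Finset.sum_comm]
  refine Finset.sum_congr rfl fun y _ => ?_
  have key : ∀ a : ℕ, (if x % j = a then f x else 0) * (if y % j = a then g y else 0)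
      = if x % j = a then (if y % j = a then f x * g y else 0) else 0 := by
    intro a
    split_ifs <;> simp
  simp_rw [key]
  rw [Finset.sum_ite_eq, if_pos (Finset.mem_range.mpr (Nat.mod_lt x hj))]
  simp only [Nat.ModEq]
  by_cases h : x % j = y % j
  · rw [if_pos h, if_pos h.symm]
  · rw [if_neg h, if_neg (fun h' => h h'.symm)]

/-- Sum of the class sums is the block sum. -/
theorem sum_classSum (f : ℕ → ℝ) (M j : ℕ) (hj : 0 < j) :
    ∑ a ∈ Finset.range j, classSum f M j a = blockSum f M := by
  unfold classSum blockSum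
  exact Finset.sum_fiberwise_of_maps_to (fun m _ => Finset.mem_range.mpr (Nat.mod_lt m hj)) f

/-- **Mean/fluctuation split** (E2), pure algebra on `ℝ^{ℤ/j}`. -/
theorem gram_split (A B : ℕ → ℝ) (j : ℕ) (hj : 0 < j) :
    ∑ a ∈ Finset.range j, A a * B a =
      (∑ a ∈ Finset.range j, A a) * (∑ a ∈ Finset.range j, B a) / j +
      ∑ a ∈ Finset.range j,
        (A a - (∑ b ∈ Finset.range j, A b) / j) * (B a - (∑ b ∈ Finset.range j, B b) / j) := by
  have hj' : (j : ℝ) ≠ 0 := by exact_mod_cast hj.ne'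
  have h1 : ∑ a ∈ Finset.range j,
        (A a - (∑ b ∈ Finset.range j, A b) / j) * (B a - (∑ b ∈ Finset.range j, B b) / j)
      = ∑ a ∈ Finset.range j, (A a * B a
          - A a * ((∑ b ∈ Finset.range j, B b) / j)
          - ((∑ b ∈ Finset.range j, A b) / j) * B a
          + ((∑ b ∈ Finset.range j, A b) / j) * ((∑ b ∈ Finset.range j, B b) / j)) := by
    refine Finset.sum_congr rfl fun a _ => by ring
  rw [h1, Finset.sum_add_distrib, Finset.sum_sub_distrib, Finset.sum_sub_distrib, ← Finset.sum_mul,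
    ← Finset.mul_sum, Finset.sum_const, Finset.card_range, nsmul_eq_mul]
  field_simp
  ring

/-- The crux's inner sum is literally `cosetSum (lamAP n c) (lamAP n' c) M j`. -/
theorem crux_term_eq (c : ℤ) (M n n' j : ℕ) :
    (∑ p ∈ (Finset.Ioc M (2 * M) ×ˢ Finset.Ioc M (2 * M)).filter (fun p : ℕ × ℕ => p.1 ≡ p.2 [MOD j]),
      (ArithmeticFunction.liouville (Int.toNat ((p.1 : ℤ) * n + c)) : ℝ) *
        (ArithmeticFunction.liouville (Int.toNat ((p.2 : ℤ) * n' + c)) : ℝ))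
      = cosetSum (lamAP n c) (lamAP n' c) M j := rfl

/-- MEAN MODE hypothesis: the rank-one term `S(n)·S(n')/j` is `≤ C·M^{3/4+ϑ}` on the crux's ranges
(`S(n) = Σ_{m∈(M,2M]} λ(mn+c)`: λ in the progression `c mod n`). First-level but already of zero-free-region
strength (card §Why it bites). -/
def MeanMode (c : ℤ) (ϑ : ℝ) : Prop :=
  ∃ C : ℝ, ∀ M n n' j : ℕ, 1 ≤ n → 1 ≤ n' → n ≠ n' → n ≤ 2 * M → n' ≤ 2 * M →
    Nat.sqrt M + 1 ≤ j → j < 2 * (Nat.sqrt M + 1) →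
      |blockSum (lamAP n c) M * blockSum (lamAP n' c) M / j| ≤ C * (M : ℝ) ^ (3 / 4 + ϑ)

/-- FLUCTUATION hypothesis: the mean-free class vectors are decorrelated, `|Σ_a Ã_n(a) Ã_{n'}(a)| ≤ C·M^{3/4+ϑ}`
(equivalently `(1/j) Σ_{b≢0} Ĝ_n(b/j) conj Ĝ_{n'}(b/j)`; Farey form in the card). Second-level. -/
def FluctMode (c : ℤ) (ϑ : ℝ) : Prop :=
  ∃ C : ℝ, ∀ M n n' j : ℕ, 1 ≤ n → 1 ≤ n' → n ≠ n' → n ≤ 2 * M → n' ≤ 2 * M →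
    Nat.sqrt M + 1 ≤ j → j < 2 * (Nat.sqrt M + 1) →
      |∑ a ∈ Finset.range j,
          (classSum (lamAP n c) M j a - blockSum (lamAP n c) M / j) *
            (classSum (lamAP n' c) M j a - blockSum (lamAP n' c) M / j)| ≤ C * (M : ℝ) ^ (3 / 4 + ϑ)

/-- **Composition** (PROVED): mean mode + fluctuation ⟹ the crux, with the same `ϑ` and `C = C₁ + C₂`. -/
theorem cosetDecorrelation_of_modes
    (h : ∀ c : ℤ, c ≠ 0 → ∃ ϑ : ℝ, ϑ < 1 / 4 ∧ MeanMode c ϑ ∧ FluctMode c ϑ) :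
    Summit.Parity.GeneralizedHardyLittlewood.Theses.LiouvilleMAD.CosetDecorrelation := by
  intro c hc
  obtain ⟨ϑ, hϑ, ⟨C₁, h₁⟩, ⟨C₂, h₂⟩⟩ := h c hc
  refine ⟨ϑ, hϑ, C₁ + C₂, ?_⟩
  intro M n n' j hn hn' hne hnM hn'M hj1 hj2
  have hj : 0 < j := by omega
  have e1 := h₁ M n n' j hn hn' hne hnM hn'M hj1 hj2
  have e2 := h₂ M n n' j hn hn' hne hnM hn'M hj1 hj2
  rw [crux_term_eq, cosetSum_eq_sum_classSum _ _ _ _ hj, gram_split _ _ _ hj,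
    sum_classSum _ _ _ hj, sum_classSum _ _ _ hj]
  calc |blockSum (lamAP n c) M * blockSum (lamAP n' c) M / ↑j +
          ∑ a ∈ Finset.range j,
            (classSum (lamAP n c) M j a - blockSum (lamAP n c) M / ↑j) *
              (classSum (lamAP n' c) M j a - blockSum (lamAP n' c) M / ↑j)|
        ≤ |blockSum (lamAP n c) M * blockSum (lamAP n' c) M / ↑j| +
          |∑ a ∈ Finset.range j,
            (classSum (lamAP n c) M j a - blockSum (lamAP n c) M / ↑j) *
              (classSum (lamAP n' c) M j a - blockSum (lamAP n' c) M / ↑j)| := abs_add_le _ _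
    _ ≤ C₁ * (M : ℝ) ^ (3 / 4 + ϑ) + C₂ * (M : ℝ) ^ (3 / 4 + ϑ) := add_le_add e1 e2
    _ = (C₁ + C₂) * (M : ℝ) ^ (3 / 4 + ϑ) := by ring


/-! ### The shift `c = 0` is a variance (positivity): all decorrelation is carried by `c ≠ 0` -/

/-- At `c = 0` the weight factors: `λ(m·n) = λ(m)·λ(n)`. -/
theorem lamAP_zero (n m : ℕ) :
    lamAP n 0 m = (ArithmeticFunction.liouville m : ℝ) * (ArithmeticFunction.liouville n : ℝ) := by
  unfold lamAP
  have : Int.toNat ((m : ℤ) * n + 0) = m * n := by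
    rw [add_zero, show ((m : ℤ) * n) = ((m * n : ℕ) : ℤ) by push_cast; ring, Int.toNat_natCast]
  rw [this, ArithmeticFunction.liouville_apply_mul]
  push_cast
  ring

/-- Class sums of a scaled weight. -/
theorem classSum_mul_const (f : ℕ → ℝ) (r : ℝ) (M j a : ℕ) :
    classSum (fun m => f m * r) M j a = classSum f M j a * r := by
  unfold classSum
  rw [Finset.sum_mul]

/-- **`c = 0` degeneration** (E0): `T_j^{(c=0)}(n,n') = λ(n)λ(n') · Σ_a A_λ(a)²` — a signed VARIANCE, of
size `≈ M` in every model; hence any proof of the crux must use `c ≠ 0` (in the Farey form: the phases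
`e(-c(α+α'))`). -/
theorem cosetSum_shift_zero (M n n' j : ℕ) (hj : 0 < j) :
    cosetSum (lamAP n 0) (lamAP n' 0) M j =
      (ArithmeticFunction.liouville n : ℝ) * (ArithmeticFunction.liouville n' : ℝ) *
        ∑ a ∈ Finset.range j, (classSum (fun m => (ArithmeticFunction.liouville m : ℝ)) M j a) ^ 2 := by
  rw [cosetSum_eq_sum_classSum _ _ _ _ hj]
  have h1 : ∀ a, classSum (lamAP n 0) M j a
      = classSum (fun m => (ArithmeticFunction.liouville m : ℝ)) M j a * (ArithmeticFunction.liouville n : ℝ) := by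
    intro a
    rw [← classSum_mul_const]
    unfold classSum
    exact Finset.sum_congr rfl fun m _ => lamAP_zero n m
  have h2 : ∀ a, classSum (lamAP n' 0) M j a
      = classSum (fun m => (ArithmeticFunction.liouville m : ℝ)) M j a * (ArithmeticFunction.liouville n' : ℝ) := by
    intro a
    rw [← classSum_mul_const]
    unfold classSum
    exact Finset.sum_congr rfl fun m _ => lamAP_zero n' m
  simp_rw [h1, h2]
  rw [Finset.mul_sum]
  exact Finset.sum_congr rfl fun a _ => by ring

/-- The variance at `c = 0` is a sum of squares (nonnegative). -/
theorem cosetSum_shift_zero_sign (M n n' j : ℕ) (hj : 0 < j) :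
    0 ≤ (ArithmeticFunction.liouville n : ℝ) * (ArithmeticFunction.liouville n' : ℝ) *
        cosetSum (lamAP n 0) (lamAP n' 0) M j := by
  rw [cosetSum_shift_zero M n n' j hj]
  have hsq : ∀ k : ℕ, (ArithmeticFunction.liouville k : ℝ) * (ArithmeticFunction.liouville k : ℝ) = 
      ((ArithmeticFunction.liouville k : ℝ)) ^ 2 := fun k => by ring
  have key : (ArithmeticFunction.liouville n : ℝ) * (ArithmeticFunction.liouville n' : ℝ) *
      ((ArithmeticFunction.liouville n : ℝ) * (ArithmeticFunction.liouville n' : ℝ) *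
        ∑ a ∈ Finset.range j, (classSum (fun m => (ArithmeticFunction.liouville m : ℝ)) M j a) ^ 2)
      = ((ArithmeticFunction.liouville n : ℝ) * (ArithmeticFunction.liouville n' : ℝ)) ^ 2 *
        ∑ a ∈ Finset.range j, (classSum (fun m => (ArithmeticFunction.liouville m : ℝ)) M j a) ^ 2 := by
    ring
  rw [key]
  exact mul_nonneg (sq_nonneg _) (Finset.sum_nonneg fun a _ => sq_nonneg _)

/-! ### Positivity over dilation families (exact; for hardness theorems, NOTES B3) -/

/-- Gram expansion of a weighted family: `Σ_a (Σ_{n∈N} w_n A_{f_n}(a))² = Σ_{n,n'∈N} w_n w_{n'} · cosetSum (f n) (f n')`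
(diagonal terms are the variances `V_n`). -/
theorem family_gram (w : ℕ → ℝ) (N : Finset ℕ) (f : ℕ → ℕ → ℝ) (M j : ℕ) (hj : 0 < j) :
    ∑ a ∈ Finset.range j, (∑ n ∈ N, w n * classSum (f n) M j a) ^ 2 =
      ∑ n ∈ N, ∑ n' ∈ N, w n * w n' * cosetSum (f n) (f n') M j := by
  simp_rw [cosetSum_eq_sum_classSum _ _ _ _ hj, Finset.mul_sum, sq, Finset.sum_mul_sum]
  rw [Finset.sum_comm]
  refine Finset.sum_congr rfl fun n _ => ?_
  rw [Finset.sum_comm]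
  refine Finset.sum_congr rfl fun n' _ => ?_
  refine Finset.sum_congr rfl fun a _ => ?_
  ring

/-- **Positivity inequality** (Cauchy–Schwarz over the `j` classes):
`(Σ_{n∈N} w_n S_{f_n})² ≤ j · Σ_{n,n'∈N} w_n w_{n'} cosetSum (f n) (f n')`. With `f n = λ(·n+c)` this bounds weighted
averages of the one-point sums `S(n)` by the coset sums: the route from `CosetDecorrelation` to Ω-theorems and zero-free-region statements. -/
theorem positivity_family (w : ℕ → ℝ) (N : Finset ℕ) (f : ℕ → ℕ → ℝ) (M j : ℕ) (hj : 0 < j) :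
    (∑ n ∈ N, w n * blockSum (f n) M) ^ 2 ≤
      (j : ℝ) * ∑ n ∈ N, ∑ n' ∈ N, w n * w n' * cosetSum (f n) (f n') M j := by
  rw [← family_gram w N f M j hj]
  have hS : ∑ n ∈ N, w n * blockSum (f n) M
      = ∑ a ∈ Finset.range j, (∑ n ∈ N, w n * classSum (f n) M j a) := by
    rw [Finset.sum_comm]
    refine Finset.sum_congr rfl fun n _ => ?_
    rw [← Finset.mul_sum, sum_classSum _ _ _ hj]
  rw [hS]
  -- elementary Cauchy–Schwarz `(Σ 1·x)² ≤ (Σ 1²)(Σ x²)`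
  have h := Finset.sum_mul_sq_le_sq_mul_sq (Finset.range j) (fun _ => (1 : ℝ))
    (fun a => ∑ n ∈ N, w n * classSum (f n) M j a)
  simp only [one_mul, one_pow, Finset.sum_const, Finset.card_range, nsmul_eq_mul, mul_one] at h
  exact h

/-! ### Statements handed to crux-plan (typed, not proved here) -/

/-- (E2′) Fourier/Plancherel form on `ℤ/j`: `T_j = (1/j) Σ_{b<j} F̂(b) · conj Ĝ(b)` with
`F̂(b) = Σ_{m∈(M,2M]} f(m) e(bm/j)`; the `b = 0` term is the MEAN MODE `S_f S_g / j`, the rest is `FluctMode`'s sum.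
Provable now (finite Fourier inversion, `ZMod.dft`); recorded as a named statement for the skeleton. -/
def FourierForm : Prop :=
  ∀ (f g : ℕ → ℝ) (M j : ℕ), 0 < j →
    (cosetSum f g M j : ℂ) =
      (1 / (j : ℂ)) * ∑ b ∈ Finset.range j,
        (∑ m ∈ Finset.Ioc M (2 * M), (f m : ℂ) * Complex.exp (2 * Real.pi * Complex.I * (b * m / (j : ℂ)))) *
        (starRingEnd ℂ) (∑ m ∈ Finset.Ioc M (2 * M), (g m : ℂ) * Complex.exp (2 * Real.pi * Complex.I * (b * m / (j : ℂ))))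

/-- (E4) Farey-lattice form of the fluctuation, the TRANSFER of the card: with `S(α; A, B) = Σ_{u∈(A,B]} λ(u)e(αu)`
(the universal Liouville exponential sum), for `c ≥ 1` (to keep ranges in `ℕ`; general `c` by symmetry/bookkeeping)
`cosetSum (λ(·n+c)) (λ(·n'+c)) M j = (1/(j n n')) Σ_{a<jn} Σ_{a'<jn', j ∣ a+a'} e(-c(a/(jn)+a'/(jn')))
  · S(a/(jn); nM+c.. ) · S(a'/(jn'); n'M+c ..)` — the pair `(u,u') = (mn+c, m'n'+c)` runs over a coset of a lattice of
covolume `j n n'` in a RECTANGLE, whose dual group is the set of LINKED Farey pairs; `c` enters only through the phase. -/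
def FareyForm : Prop :=
  ∀ (c : ℕ) (M n n' j : ℕ), 1 ≤ c → 0 < j → 1 ≤ n → 1 ≤ n' →
    (cosetSum (lamAP n c) (lamAP n' c) M j : ℂ) =
      (1 / ((j : ℂ) * n * n')) *
        ∑ a ∈ Finset.range (j * n), ∑ a' ∈ (Finset.range (j * n')).filter (fun a' => j ∣ a + a'),
          Complex.exp (-(2 * Real.pi * Complex.I * (c : ℂ) * ((a : ℂ) / (j * n : ℂ) + (a' : ℂ) / (j * n' : ℂ)))) *
          (∑ u ∈ Finset.Ioc (n * M + c) (2 * n * M + c),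
              (ArithmeticFunction.liouville u : ℂ) * Complex.exp (2 * Real.pi * Complex.I * ((a : ℂ) / (j * n : ℂ)) * u)) *
          (∑ u ∈ Finset.Ioc (n' * M + c) (2 * n' * M + c),
              (ArithmeticFunction.liouville u : ℂ) * Complex.exp (2 * Real.pi * Complex.I * ((a' : ℂ) / (j * n' : ℂ)) * u))

end Summit.Parity.GeneralizedHardyLittlewood.Cruxes.CosetDecorrelation.SketchIdeator2
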